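import Summits.ABC.ABC.Theses.RibetTakahashiSplit
import Summits.ABC.ABC.Theorems.RibetTakahashiSplitFewPrimeValuationProductOfPartsGlue
import Summits.ABC.ABC.Theorems.RibetTakahashiSplitFewPrimeValuationProductStubFaceBound
import Summits.ABC.ABC.Theorems.RibetTakahashiSplitFewPrimeValuationProductStubSmallPrimeClearing
import Summits.ABC.ABC.Theorems.RibetTakahashiSplitFewPrimeValuationProductStubDecisivePrimeBootstrap

/-!
# Line `matveev-face-clearing` for crux `FewPrimeValuationProduct` (stmt-ABC-1563): the conditional compositions

Support file (`--supports stmt-ABC-1563`). With the three cell stubs of the line LANDED unconditionally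
(`stub_faceBound`, `stub_smallPrimeClearing`, `stub_decisivePrimeBootstrap`, all implications from the LFL input
`∃ K ≥ 1, Dioph.PastenApproximationBound K` = Matveev + Yu over `ℚ` in Pasten's form), the line's content becomes two
KERNEL-CLOSED conditional theorems (no `sorry`; the open inputs are explicit hypotheses, stated verbatim as the registered stubs
`stub_lflInput`, `stub_twoLogOnePrime`, `stub_nonFreyResidual` of the skeleton):

* `freyValuationProduct_of_lfl_of_twoLog` (registered sub-goal) — **the Frey part of r4**: LFL input ∧ TwoLogOnePrime(η) ⟹
  `∀ ε > 0 ∃ K ∀ abc triples with ω(abc) ≤ 4, ∏_{p∣abc} v_p(abc) ≤ K rad^ε`;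
* `fewPrimeValuationProduct_of_parts` (registered sub-goal) — LFL input ∧ TwoLogOnePrime(η) ∧ NonFreyResidual ⟹ the crux
  `FewPrimeValuationProduct` by name, through the numerical Frey dictionary `T(W) ≤ 16 ∏ v_p(abc)`, `rad ≤ 2N`
  (`crux_of_frey_of_residual`, re-homed skeleton glue).

Status of the hypotheses (2026-08-16): LFL input = named fact `Dioph.evertseGyory_thm_4_2_1_rat` (conditional discharge
`stub_lflInput_of_evertseGyory`); TwoLogOnePrime OPEN (`BakerMethodBounds` clause (i), smallest instance; weak Yu-defect form
`stub_twoLogOnePrime_weak` proved); NonFreyResidual OPEN (the crux on curves without a numerical Frey shadow — Szpiro-strength on its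
class). Nothing here is a proof of the item; the audit's `proof.conditional`-type reading is the intended one.
-/

-- `Summit.<Summit>.<Problem>`: for the single-conjunct summit `ABC` the duplicate `ABC.ABC` is mandated.
set_option linter.dupNamespace false

noncomputable section

namespace Summit.ABC.ABC.Theorems.FewPrimeValuationProduct

open scoped BigOperators
open Finset
open Literature.NumberTheory.DiophantineGeometry

/-! ## Glue, part 2 (sorry-free): the numerical Frey dictionary and the crux by name -/

/-- Cardinality bookkeeping: a set of primes each of which is `2` or lies in `F` has at most `#F + 1`
elements. [folklore] -/
theorem card_le_of_subset_insert_two {S F : Finset ℕ} (h : ∀ p ∈ S, p ≠ 2 → p ∈ F) :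
    S.card ≤ F.card + 1 := by
  have hsub : S ⊆ insert 2 F := by
    intro p hp
    by_cases hp2 : p = 2
    · rw [hp2]; exact Finset.mem_insert_self 2 F
    · exact Finset.mem_insert_of_mem (h p hp hp2)
  exact (Finset.card_le_card hsub).trans (Finset.card_insert_le 2 F)

/-- **The numerical Frey dictionary** (ℕ-level): if the component orders of `(N, D)` at the primes `p ∥ N` are
dominated by twice the exponents of `n = abc`, and at most `3` odd primes `p ∥ N` occur, then
`∏_{p ∥ N} ord_p D ≤ 16 · ∏_{p ∣ n} v_p(n)`. [folklore] -/
theorem weight_le_sixteen_mul {N D n : ℕ} (hn : n ≠ 0)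
    (hcard : (N.primeFactors.filter (fun p => p ≠ 2 ∧ ¬ p ^ 2 ∣ N)).card ≤ 3)
    (hfac : ∀ p ∈ N.primeFactors, ¬ p ^ 2 ∣ N → D.factorization p ≤ 2 * n.factorization p) :
    ∏ p ∈ N.primeFactors with ¬ p ^ 2 ∣ N, D.factorization p ≤
      16 * ∏ p ∈ n.primeFactors, n.factorization p := by
  classical
  set S := N.primeFactors.filter (fun p => ¬ p ^ 2 ∣ N) with hS
  set F := N.primeFactors.filter (fun p => p ≠ 2 ∧ ¬ p ^ 2 ∣ N) with hF
  -- #S ≤ 4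
  have hSF : ∀ p ∈ S, p ≠ 2 → p ∈ F := by
    intro p hp hp2
    rw [hS, Finset.mem_filter] at hp
    rw [hF, Finset.mem_filter]
    exact ⟨hp.1, hp2, hp.2⟩
  have hScard : S.card ≤ 4 := (card_le_of_subset_insert_two hSF).trans (by omega)
  -- step 1: termwise domination
  have h1 : ∏ p ∈ S, D.factorization p ≤ ∏ p ∈ S, 2 * n.factorization p := by
    apply Finset.prod_le_prod'
    intro p hp
    rw [hS, Finset.mem_filter] at hp
    exact hfac p hp.1 hp.2
  -- step 2: pull out the 2's
  have h2 : ∏ p ∈ S, 2 * n.factorization p = 2 ^ S.card * ∏ p ∈ S, n.factorization p := by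
    rw [Finset.prod_mul_distrib, Finset.prod_const]
  have h3 : 2 ^ S.card ≤ 16 := by
    calc 2 ^ S.card ≤ 2 ^ 4 := Nat.pow_le_pow_right (by norm_num) hScard
      _ = 16 := by norm_num
  -- step 3: compare the index sets
  have h4 : ∏ p ∈ S, n.factorization p ≤ ∏ p ∈ n.primeFactors, n.factorization p := by
    by_cases hsub : S ⊆ n.primeFactors
    · apply Finset.prod_le_prod_of_subset_of_one_le' hsub
      intro p hp _
      obtain ⟨hpp, hpn, -⟩ := Nat.mem_primeFactors.mp hp
      exact hpp.factorization_pos_of_dvd hn hpn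
    · -- some p ∈ S is not a prime factor of n: its exponent is 0 and the product vanishes
      rw [Finset.not_subset] at hsub
      obtain ⟨p, hpS, hpn⟩ := hsub
      have h0 : n.factorization p = 0 := by
        rw [← Nat.support_factorization] at hpn
        exact Finsupp.notMem_support_iff.mp hpn
      rw [Finset.prod_eq_zero hpS h0]
      exact Nat.zero_le _
  calc ∏ p ∈ S, D.factorization p ≤ ∏ p ∈ S, 2 * n.factorization p := h1
    _ = 2 ^ S.card * ∏ p ∈ S, n.factorization p := h2
    _ ≤ 16 * ∏ p ∈ n.primeFactors, n.factorization p := Nat.mul_le_mul h3 h4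

/-- The radical of a shadow triple is at most `2N`: every odd prime of `abc` divides `N`, and `2 ∣ 2N`.
[folklore] -/
theorem rad_le_two_mul {a b c N : ℕ} (hN : 0 < N)
    (hodd : ∀ p : ℕ, p.Prime → p ≠ 2 → p ∣ a * b * c → p ∣ N) : rad a b c ≤ 2 * N := by
  classical
  rw [rad_def, Nat.radical_eq_prod_primeFactors]
  apply Nat.le_of_dvd (by omega)
  apply Finset.prod_primes_dvd (2 * N)
  · intro p hp
    exact (Nat.prime_of_mem_primeFactors hp).prime
  · intro p hp
    obtain ⟨hpp, hpn, -⟩ := Nat.mem_primeFactors.mp hp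
    by_cases hp2 : p = 2
    · rw [hp2]; exact dvd_mul_right 2 N
    · exact (hodd p hpp hp2 hpn).mul_left 2

/-- The prime factors of a shadow triple: at most `#F + 1 ≤ 4`, where `F` is the crux's set of odd
multiplicative primes. [folklore] -/
theorem card_primeFactors_le_four_of_shadow {a b c N : ℕ} (hN : 0 < N)
    (hss : ∀ p : ℕ, p.Prime → p ≠ 2 → ¬ p ^ 2 ∣ N)
    (hcard : (N.primeFactors.filter (fun p => p ≠ 2 ∧ ¬ p ^ 2 ∣ N)).card ≤ 3)
    (hodd : ∀ p : ℕ, p.Prime → p ≠ 2 → p ∣ a * b * c → p ∣ N) :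
    (a * b * c).primeFactors.card ≤ 4 := by
  have h : ∀ p ∈ (a * b * c).primeFactors, p ≠ 2 →
      p ∈ N.primeFactors.filter (fun p => p ≠ 2 ∧ ¬ p ^ 2 ∣ N) := by
    intro p hp hp2
    obtain ⟨hpp, hpn, -⟩ := Nat.mem_primeFactors.mp hp
    rw [Finset.mem_filter, Nat.mem_primeFactors]
    exact ⟨⟨hpp, hodd p hpp hp2 hpn, hN.ne'⟩, hp2, hss p hpp hp2⟩
  exact (card_le_of_subset_insert_two h).trans (by omega)

/-- **The crux from its Frey part and the non-Frey residual** (crux unfolded; only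
`FewPrimeValuationProduct_of` below concludes the route decl by name). Given `ε`: on a curve with a Frey shadow
`(a, b, c)`, `T(W) ≤ 16 ∏ v_p(abc) ≤ 16 K rad^ε ≤ 16 K (2N)^ε`; otherwise the residual. [folklore] -/
theorem crux_of_frey_of_residual
    (hF : ∀ ε : ℝ, 0 < ε → ∃ K : ℝ, ∀ a b c : ℕ, IsABCTriple a b c → (a * b * c).primeFactors.card ≤ 4 →
      ((∏ p ∈ (a * b * c).primeFactors, (a * b * c).factorization p : ℕ) : ℝ) ≤ K * (rad a b c : ℝ) ^ ε)
    (hR : ∀ ε : ℝ, 0 < ε → ∃ C : ℝ, ∀ (W : WeierstrassCurve ℚ) [W.IsElliptic],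
      (∀ p : ℕ, p.Prime → p ≠ 2 → ¬ p ^ 2 ∣ W.conductorNorm ℤ) →
      ((W.conductorNorm ℤ).primeFactors.filter (fun p => p ≠ 2 ∧ ¬ p ^ 2 ∣ W.conductorNorm ℤ)).card ≤ 3 →
      (¬ ∃ a b c : ℕ, IsABCTriple a b c ∧
          (∀ p : ℕ, p.Prime → p ≠ 2 → p ∣ a * b * c → p ∣ W.conductorNorm ℤ) ∧
          (∀ p ∈ (W.conductorNorm ℤ).primeFactors, ¬ p ^ 2 ∣ W.conductorNorm ℤ →
            (W.minimalDiscriminantNorm ℤ).factorization p ≤ 2 * (a * b * c).factorization p)) →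
      ((∏ p ∈ (W.conductorNorm ℤ).primeFactors with ¬ p ^ 2 ∣ W.conductorNorm ℤ,
          (W.minimalDiscriminantNorm ℤ).factorization p : ℕ) : ℝ) ≤ C * (W.conductorNorm ℤ : ℝ) ^ ε) :
    ∀ ε : ℝ, 0 < ε → ∃ C : ℝ, ∀ (W : WeierstrassCurve ℚ) [W.IsElliptic],
      (∀ p : ℕ, p.Prime → p ≠ 2 → ¬ p ^ 2 ∣ W.conductorNorm ℤ) →
      ((W.conductorNorm ℤ).primeFactors.filter (fun p => p ≠ 2 ∧ ¬ p ^ 2 ∣ W.conductorNorm ℤ)).card ≤ 3 →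
      ((∏ p ∈ (W.conductorNorm ℤ).primeFactors with ¬ p ^ 2 ∣ W.conductorNorm ℤ,
          (W.minimalDiscriminantNorm ℤ).factorization p : ℕ) : ℝ) ≤ C * (W.conductorNorm ℤ : ℝ) ^ ε := by
  intro ε hε
  obtain ⟨K, hK⟩ := hF ε hε
  obtain ⟨C₅, hC₅⟩ := hR ε hε
  refine ⟨max (16 * (2 : ℝ) ^ ε * max K 0) (max C₅ 0), ?_⟩
  intro W _ hss hcard
  have hNpos : 0 < W.conductorNorm ℤ := W.conductorNorm_pos_holds
  have hN0 : (0 : ℝ) ≤ (W.conductorNorm ℤ : ℝ) := Nat.cast_nonneg _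
  have hNε : (0 : ℝ) ≤ (W.conductorNorm ℤ : ℝ) ^ ε := Real.rpow_nonneg hN0 ε
  by_cases hsh : ∃ a b c : ℕ, IsABCTriple a b c ∧
      (∀ p : ℕ, p.Prime → p ≠ 2 → p ∣ a * b * c → p ∣ W.conductorNorm ℤ) ∧
      (∀ p ∈ (W.conductorNorm ℤ).primeFactors, ¬ p ^ 2 ∣ W.conductorNorm ℤ →
        (W.minimalDiscriminantNorm ℤ).factorization p ≤ 2 * (a * b * c).factorization p)
  · -- a Frey shadow exists: dictionary + the Frey part
    obtain ⟨a, b, c, habc, hodd, hfac⟩ := hsh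
    have hn0 : a * b * c ≠ 0 := by
      obtain ⟨ha, hb, hsum, -⟩ := habc
      have hc : 0 < c := by omega
      positivity
    have hcard4 : (a * b * c).primeFactors.card ≤ 4 :=
      card_primeFactors_le_four_of_shadow hNpos hss hcard hodd
    have hT : ∏ p ∈ (W.conductorNorm ℤ).primeFactors with ¬ p ^ 2 ∣ W.conductorNorm ℤ,
        (W.minimalDiscriminantNorm ℤ).factorization p ≤
        16 * ∏ p ∈ (a * b * c).primeFactors, (a * b * c).factorization p :=
      weight_le_sixteen_mul hn0 hcard hfac
    have hT' : ((∏ p ∈ (W.conductorNorm ℤ).primeFactors with ¬ p ^ 2 ∣ W.conductorNorm ℤ,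
        (W.minimalDiscriminantNorm ℤ).factorization p : ℕ) : ℝ) ≤
        16 * ((∏ p ∈ (a * b * c).primeFactors, (a * b * c).factorization p : ℕ) : ℝ) := by
      exact_mod_cast hT
    have hP : ((∏ p ∈ (a * b * c).primeFactors, (a * b * c).factorization p : ℕ) : ℝ) ≤
        K * (rad a b c : ℝ) ^ ε := hK a b c habc hcard4
    have hrad0 : (0 : ℝ) ≤ (rad a b c : ℝ) := Nat.cast_nonneg _
    have hradε : (0 : ℝ) ≤ (rad a b c : ℝ) ^ ε := Real.rpow_nonneg hrad0 ε
    have hrad2N : (rad a b c : ℝ) ≤ 2 * (W.conductorNorm ℤ : ℝ) := by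
      have := rad_le_two_mul hNpos hodd
      exact_mod_cast this
    have hpow : (rad a b c : ℝ) ^ ε ≤ (2 : ℝ) ^ ε * (W.conductorNorm ℤ : ℝ) ^ ε := by
      rw [← Real.mul_rpow zero_le_two hN0]
      exact Real.rpow_le_rpow hrad0 hrad2N hε.le
    have hK0 : 0 ≤ max K 0 := le_max_right _ _
    calc ((∏ p ∈ (W.conductorNorm ℤ).primeFactors with ¬ p ^ 2 ∣ W.conductorNorm ℤ,
          (W.minimalDiscriminantNorm ℤ).factorization p : ℕ) : ℝ)
        ≤ 16 * ((∏ p ∈ (a * b * c).primeFactors, (a * b * c).factorization p : ℕ) : ℝ) := hT'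
      _ ≤ 16 * (K * (rad a b c : ℝ) ^ ε) := by linarith
      _ ≤ 16 * (max K 0 * (rad a b c : ℝ) ^ ε) := by
          apply mul_le_mul_of_nonneg_left _ (by norm_num)
          exact mul_le_mul_of_nonneg_right (le_max_left _ _) hradε
      _ ≤ 16 * (max K 0 * ((2 : ℝ) ^ ε * (W.conductorNorm ℤ : ℝ) ^ ε)) := by
          apply mul_le_mul_of_nonneg_left _ (by norm_num)
          exact mul_le_mul_of_nonneg_left hpow hK0
      _ = (16 * (2 : ℝ) ^ ε * max K 0) * (W.conductorNorm ℤ : ℝ) ^ ε := by ring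
      _ ≤ max (16 * (2 : ℝ) ^ ε * max K 0) (max C₅ 0) * (W.conductorNorm ℤ : ℝ) ^ ε :=
          mul_le_mul_of_nonneg_right (le_max_left _ _) hNε
  · -- no Frey shadow: the residual
    have h := hC₅ W hss hcard hsh
    calc ((∏ p ∈ (W.conductorNorm ℤ).primeFactors with ¬ p ^ 2 ∣ W.conductorNorm ℤ,
          (W.minimalDiscriminantNorm ℤ).factorization p : ℕ) : ℝ)
        ≤ C₅ * (W.conductorNorm ℤ : ℝ) ^ ε := h
      _ ≤ max C₅ 0 * (W.conductorNorm ℤ : ℝ) ^ ε := mul_le_mul_of_nonneg_right (le_max_left _ _) hNε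
      _ ≤ max (16 * (2 : ℝ) ^ ε * max K 0) (max C₅ 0) * (W.conductorNorm ℤ : ℝ) ^ ε :=
          mul_le_mul_of_nonneg_right (le_max_right _ _) hNε

/-! ## The conditional compositions -/

/-- **The Frey part of r4, conditionally** (registered sub-goal `freyValuationProduct_of_lfl_of_twoLog`): from the LFL input
(Matveev + Yu in Pasten's form, the statement of `stub_lflInput`) and the open two-logarithm estimate `TwoLogOnePrime(η)` (the
statement of `stub_twoLogOnePrime`), every abc triple supported on `≤ 4` primes has `∏_{p ∣ abc} v_p(abc) ≤ K_ε · rad^ε`.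
Composition of the LANDED cells `stub_faceBound` (face), `stub_smallPrimeClearing` (small odd prime) and
`stub_decisivePrimeBootstrap` (balanced hard core) through `face_rpow_of_polylog` and `frey_of_parts`. [folklore] -/
theorem freyValuationProduct_of_lfl_of_twoLog :
    (∃ K : ℝ, 1 ≤ K ∧ Literature.NumberTheory.DiophantineGeometry.Dioph.PastenApproximationBound K) → (∃ η : ℝ, 0 < η ∧ ∀ ε : ℝ, 0 < ε → ∃ (A : ℕ) (C : ℝ), ∀ ℓ p q : ℕ, ℓ.Prime → p.Prime → q.Prime → ℓ ≠ 2 → p ≠ 2 → q ≠ 2 → ℓ ≠ p → ℓ ≠ q → p ≠ q → ∀ x y k : ℕ, 1 ≤ x → 1 ≤ y → ∀ σ : ℤ, (σ = 1 ∨ σ = -1) → (ℓ : ℝ) ^ ε ≤ (padicValInt ℓ ((p : ℤ) ^ x + σ * 2 ^ k * (q : ℤ) ^ y) : ℝ) → (padicValInt ℓ ((p : ℤ) ^ x + σ * 2 ^ k * (q : ℤ) ^ y) : ℝ) ≤ C * (ℓ : ℝ) ^ ε * (Real.log p * Real.log q * (k + 1)) ^ A * ((max x y : ℕ) : ℝ)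 ^ (1 - η)) → ∀ ε : ℝ, 0 < ε → ∃ K : ℝ, ∀ a b c : ℕ, Literature.NumberTheory.DiophantineGeometry.IsABCTriple a b c → (a * b * c).primeFactors.card ≤ 4 → ((∏ p ∈ (a * b * c).primeFactors, (a * b * c).factorization p : ℕ) : ℝ) ≤ K * (Literature.NumberTheory.DiophantineGeometry.rad a b c : ℝ) ^ ε :=
  fun hL hT => frey_of_parts (face_rpow_of_polylog (stub_faceBound hL)) (stub_smallPrimeClearing hL)
    (stub_decisivePrimeBootstrap hL hT)

/-- **The crux from its three open inputs** (registered sub-goal `fewPrimeValuationProduct_of_parts`): LFL input ∧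
TwoLogOnePrime(η) ∧ NonFreyResidual ⟹ `FewPrimeValuationProduct`, by the numerical Frey dictionary
`crux_of_frey_of_residual` applied to `freyValuationProduct_of_lfl_of_twoLog`. This is the line's skeleton theorem
`FewPrimeValuationProduct_of` with its three remaining `sorry`s turned into hypotheses — a CONDITIONAL result, not a proof of
the item. [folklore] -/
theorem fewPrimeValuationProduct_of_parts :
    (∃ K : ℝ, 1 ≤ K ∧ Literature.NumberTheory.DiophantineGeometry.Dioph.PastenApproximationBound K) → (∃ η : ℝ, 0 < η ∧ ∀ ε : ℝ, 0 < ε → ∃ (A : ℕ) (C : ℝ), ∀ ℓ p q : ℕ, ℓ.Prime → p.Prime → q.Prime → ℓ ≠ 2 → p ≠ 2 → q ≠ 2 → ℓ ≠ p → ℓ ≠ q → p ≠ q → ∀ x y k : ℕ, 1 ≤ x → 1 ≤ y → ∀ σ : ℤ, (σ = 1 ∨ σ = -1) → (ℓ : ℝ) ^ ε ≤ (padicValInt ℓ ((p : ℤ) ^ x + σ * 2 ^ k * (q : ℤ) ^ y) : ℝ) → (padicValInt ℓ ((p : ℤ) ^ x + σ * 2 ^ k * (q : ℤ) ^ y) :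 ℝ) ≤ C * (ℓ : ℝ) ^ ε * (Real.log p * Real.log q * (k + 1)) ^ A * ((max x y : ℕ) : ℝ) ^ (1 - η)) → (∀ ε : ℝ, 0 < ε → ∃ C : ℝ, ∀ (W : WeierstrassCurve ℚ) [W.IsElliptic], (∀ p : ℕ, p.Prime → p ≠ 2 → ¬ p ^ 2 ∣ W.conductorNorm ℤ) → ((W.conductorNorm ℤ).primeFactors.filter (fun p => p ≠ 2 ∧ ¬ p ^ 2 ∣ W.conductorNorm ℤ)).card ≤ 3 → (¬ ∃ a b c : ℕ, Literature.NumberTheory.DiophantineGeometry.IsABCTriple a b c ∧ (∀ p : ℕ, p.Prime → p ≠ 2 → p ∣ a * b * c → p ∣ W.conductorNorm ℤ) ∧ (∀ p ∈ (W.conductorNorm ℤ).primeFactors, ¬ p ^ 2 ∣ W.conductorNorm ℤ → (W.minimalDiscriminantNorm ℤ).factorization p ≤ 2 * (a * b * c).factorization p)) → ((∏ p ∈ (W.conductorNorm ℤ).primeFactors with ¬ p ^ 2 ∣ W.conductorNorm ℤ, (W.minimalDiscriminantNorm ℤ).factorization p : ℕ) : ℝ) ≤ C * (W.conductorNorm ℤ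 : ℝ) ^ ε) → Summit.ABC.ABC.Theses.RibetTakahashiSplit.FewPrimeValuationProduct :=
  fun hL hT hR => crux_of_frey_of_residual (freyValuationProduct_of_lfl_of_twoLog hL hT) hR

end Summit.ABC.ABC.Theorems.FewPrimeValuationProduct

end
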